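import Summits.Ventures.YMGap.RobustBall.TorusRowsSU2StarW
import Summits.Ventures.YMGap.RobustBall.TorusRowsSU2Variance
import HarnessLib

/-!
# Venture YMGap, track ROBUST-BALL (Y2) / Y4 bridge — crux Y2-X2-W, step W7: the `SU(2)`, `d = 3` ROWS of the robust
# vertex-star door on the TIER-2 (weighted) torus ball = Y4's receiving currency `ClusterDomainClustering` on
# `ClusterDomain κ (2ε) ε`

HONEST FRAMING. WHAT THIS IS: a venture file (cell `pub-ymgap`, track Y2 ROBUST-BALL, seat ds-2): the `d = 3` twin of
`TorusRowsSU2StarW` — numeric instances of `clusterDomainClusteringW_dim3_of_robustStar` for `SU(2)` on the quarter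
modulus (door polynomial `8c² + 6c < 1`, `θ = 4c + λ`, weighted door `T₁·(R_G^{(3)}(c) + (T₂λ + θ^{20}·12·T₂λ)/(1−θ)) < 1`),
every row an exact-rational certificate checked by `norm_num`. ROWS (β_W, ε), HYPOTHESIS-FREE, class K, currency
`YM3IR.ClusterDomainClustering ⟨fundamentalRep (Fin 2), β_W/2, · ∈ ClusterDomain κ (2ε) ε⟩ suFrobDist t` (+ the torus form
`TorusClusteringOnBallW 2 3 β κ (2ε) ε (16e^{2t}) t` for `0 ≤ β ≤ β_W/2`): at `t = 1/100` for EVERY `κ ≥ 1/100`: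
(1/4, .112) (3/10, .089) (2/5, .049) (1/2, .016); at the lineage weight `κ = t = log(6/5)`: (1/4, .083) (1/3, .051)
(9/20, .014); at `κ = t = log(3/2)`: (1/4, .049) (1/3, .025). BEFORE: Y4's weighted `d = 3` rows came from the single-link
door (`TorusRowsYM3W`, Wilson threshold `e^{−κ}/3`): (1/8, log 6/5, .18), (1/4, log 6/5, ·). WHAT THIS IS NOT: radii and
rates are door artefacts; torus currency; nothing about the continuum limit or the Millennium problem.

## References
* The tree: `RobustStarDoorW.lean`, `TorusRowsSU2StarW.lean` (this seat), `TorusRowsSU2Star.lean`, `TorusRowsYM3W.lean`.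
-/

noncomputable section

open Finset
open Literature.MathematicalPhysics.QuantumLattice (fundamentalRep)
open Literature.MathematicalPhysics.QuantumFieldTheory hiding ZdEdge
open Literature.MathematicalPhysics.QuantumFieldTheory.Balaban1983to89.StrongCouplingTorusWindow
open Literature.MathematicalPhysics.QuantumFieldTheory.Balaban1983to89.StrongCouplingDobrushinWindow
  (OneLinkKRModulus OneLinkKRModulusSU2)
open Summit.Ventures.YMGap.StarResolventDim (Delta gaugeR doorPoly Delta_pos_of_door gaugeR_lt_one_of_door)

namespace Summit.Ventures.YMGap.RobustBall

/-! ### Certified decimal majorants -/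

/-- `e^{89 / 500} ≤ 597413 / 500000` (Mathlib's `Real.exp_bound'`, five terms). [folklore] -/
theorem exp_le_89_500_w3 : Real.exp (89 / 500) ≤ 597413 / 500000 := by
  have h := Real.exp_bound' (x := 89 / 500) (by norm_num) (by norm_num) (n := 5) (by norm_num)
  refine h.trans ?_
  simp only [Finset.sum_range_succ, Finset.sum_range_zero, Nat.factorial]
  norm_num

/-- `e^{4 / 125} ≤ 516259 / 500000` (Mathlib's `Real.exp_bound'`, five terms). [folklore] -/
theorem exp_le_4_125_w3 : Real.exp (4 / 125) ≤ 516259 / 500000 := by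
  have h := Real.exp_bound' (x := 4 / 125) (by norm_num) (by norm_num) (n := 5) (by norm_num)
  refine h.trans ?_
  simp only [Finset.sum_range_succ, Finset.sum_range_zero, Nat.factorial]
  norm_num

/-- `e^{7 / 250} ≤ 257099 / 250000` (Mathlib's `Real.exp_bound'`, five terms). [folklore] -/
theorem exp_le_7_250_w3 : Real.exp (7 / 250) ≤ 257099 / 250000 := by
  have h := Real.exp_bound' (x := 7 / 250) (by norm_num) (by norm_num) (n := 5) (by norm_num)
  refine h.trans ?_
  simp only [Finset.sum_range_succ, Finset.sum_range_zero, Nat.factorial]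
  norm_num

/-- `e^{1 / 20} ≤ 131409 / 125000` (Mathlib's `Real.exp_bound'`, five terms). [folklore] -/
theorem exp_le_1_20_w3 : Real.exp (1 / 20) ≤ 131409 / 125000 := by
  have h := Real.exp_bound' (x := 1 / 20) (by norm_num) (by norm_num) (n := 5) (by norm_num)
  refine h.trans ?_
  simp only [Finset.sum_range_succ, Finset.sum_range_zero, Nat.factorial]
  norm_num

/-! ### The schema: `SU(2)`, `d = 3`, tier-2 ball, weighted robust star door -/

/-- **SCHEMA, `SU(2)`, `d = 3`: Y4's receiving currency `YM3IR.ClusterDomainClustering` on the TIER-2 ball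
`ClusterDomain κ ε₀ ε₁` up to `β_W/2` through the WEIGHTED ROBUST STAR DOOR**, at rate `t` (`0 ≤ t ≤ κ`; `0 < β_W ≤ 2/3`;
door polynomial `8c² + 6c < 1`, `θ = 4c + λ`, `T₁·(gaugeR 3 c + (T₂λ + θ^K·12·T₂λ)/(1−θ)) < 1`); also the torus form. [folklore] -/
theorem su2_clusterDomainClusteringW_dim3_star (Kn : ℕ) {βW κ ε₀ ε₁ c lam E S t T₁ T₂ : ℝ} (hβ0 : 0 < βW)
    (hβ : βW ≤ 2 / 3) (hε₁ : 0 ≤ ε₁) (ht : 0 ≤ t) (htκ : t ≤ κ) (hE : Real.exp ε₀ ≤ E) (hS : Real.sqrt 2 ≤ S)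
    (hT₁ : Real.exp t ≤ T₁) (hT₂ : Real.exp (2 * t) ≤ T₂) (hc : E * (1 + 2 * S * ε₁) * (βW / 4) ≤ c)
    (hlam : S * ε₁ ≤ lam) (hθ1 : 4 * c + lam < 1) (hcd : doorPoly 3 c < 1)
    (hρ1 : T₁ * (gaugeR 3 c + (T₂ * lam + (4 * c + lam) ^ Kn * (12 * (T₂ * lam))) / (1 - (4 * c + lam))) < 1) :
    YM3IR.ClusterDomainClustering (G := SUN 2)
        ⟨fundamentalRep (Fin 2), βW / 2, fun _ _ W => W ∈ ClusterDomain κ ε₀ ε₁⟩ suFrobDist t ∧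
      ∀ β : ℝ, 0 ≤ β → β ≤ βW / 2 → TorusClusteringOnBallW 2 3 β κ ε₀ ε₁ (16 * Real.exp (2 * t)) t := by
  have hS0 : 0 ≤ S := (Real.sqrt_nonneg _).trans hS
  have hE0 : 0 ≤ E := (Real.exp_pos _).le.trans hE
  have hc0 : 0 ≤ c := le_trans (by positivity) hc
  have hlam0 : 0 ≤ lam := le_trans (by positivity) hlam
  set θ : ℝ := 4 * c + lam with hθ
  set ρ : ℝ := Real.exp t * (gaugeR 3 c +
    (Real.exp (2 * t) * lam + θ ^ Kn * (12 * (Real.exp (2 * t) * lam))) / (1 - θ)) with hρ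
  have hθ0 : 0 ≤ θ := by positivity
  have h1θ : 0 < 1 - θ := by linarith
  have hgR := gaugeR_lt_one_of_door (d := 3) (by norm_num) hc0 hcd
  have hθK : 0 ≤ θ ^ Kn := pow_nonneg hθ0 Kn
  have hin0 : 0 ≤ gaugeR 3 c + (Real.exp (2 * t) * lam + θ ^ Kn * (12 * (Real.exp (2 * t) * lam))) / (1 - θ) :=
    add_nonneg hgR.1 (div_nonneg (by positivity) h1θ.le)
  have hin : gaugeR 3 c + (Real.exp (2 * t) * lam + θ ^ Kn * (12 * (Real.exp (2 * t) * lam))) / (1 - θ) ≤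
      gaugeR 3 c + (T₂ * lam + θ ^ Kn * (12 * (T₂ * lam))) / (1 - θ) := by
    have h1 : Real.exp (2 * t) * lam ≤ T₂ * lam := mul_le_mul_of_nonneg_right hT₂ hlam0
    have h2 : θ ^ Kn * (12 * (Real.exp (2 * t) * lam)) ≤ θ ^ Kn * (12 * (T₂ * lam)) :=
      mul_le_mul_of_nonneg_left (by linarith) hθK
    exact add_le_add le_rfl (div_le_div_of_nonneg_right (add_le_add h1 h2) h1θ.le)
  have hρ1' : ρ < 1 :=
    calc ρ ≤ T₁ * (gaugeR 3 c + (T₂ * lam + θ ^ Kn * (12 * (T₂ * lam))) / (1 - θ)) :=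
          mul_le_mul hT₁ hin hin0 ((Real.exp_pos _).le.trans hT₁)
      _ < 1 := hρ1
  have hR : βW / 2 / ((2 : ℕ) : ℝ) * 4 ≤ 3 * βW / 2 := by push_cast; linarith
  have hR' : βW / 2 / ((2 : ℕ) : ℝ) * (2 * (((3 : ℕ) : ℝ) - 1)) ≤ 3 * βW / 2 := by push_cast; linarith
  have hc' : (1 : ℝ) * Real.exp ε₀ * (1 + 2 * Real.sqrt ((2 : ℕ) : ℝ) * ε₁) * (βW / 2 / ((2 : ℕ) : ℝ)) ≤ c := by
    refine le_trans ?_ hc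
    have h1 : Real.sqrt ((2 : ℕ) : ℝ) = Real.sqrt 2 := by norm_num
    rw [h1, one_mul]
    have h4 : βW / 2 / ((2 : ℕ) : ℝ) = βW / 4 := by push_cast; ring
    rw [h4]
    have hb : 0 ≤ βW / 4 := by positivity
    calc Real.exp ε₀ * (1 + 2 * Real.sqrt 2 * ε₁) * (βW / 4) ≤ E * (1 + 2 * Real.sqrt 2 * ε₁) * (βW / 4) := by
          gcongr
      _ ≤ E * (1 + 2 * S * ε₁) * (βW / 4) := by gcongr
  have hlam' : Real.sqrt ((2 : ℕ) : ℝ) * ε₁ ≤ lam := by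
    have h1 : Real.sqrt ((2 : ℕ) : ℝ) = Real.sqrt 2 := by norm_num
    rw [h1]; exact le_trans (mul_le_mul_of_nonneg_right hS hε₁) hlam
  have hθ' : θ = (2 * ((3 : ℕ) : ℝ) - 2) * c + lam := by rw [hθ]; push_cast; ring
  have hρ' : ρ = Real.exp t * (gaugeR 3 c +
      (Real.exp (2 * t) * lam + θ ^ Kn * (4 * ((3 : ℕ) : ℝ) * (Real.exp (2 * t) * lam))) / (1 - θ)) := by
    rw [hρ]; push_cast; ring
  refine ⟨clusterDomainClusteringW_dim3_of_robustStar (N := 2) (by norm_num) Kn zero_le_one hR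
    (su2_quarterModulus hβ) hε₁ ht htκ hc' hlam' hθ hθ1 hcd hρ hρ1', ?_⟩
  have h := torusClusteringOnBallW_upTo_of_robustStar (d := 3) (N := 2) (by norm_num) (by norm_num) Kn zero_le_one hR'
    (su2_quarterModulus hβ) hε₁ ht htκ hc' hlam' hθ' hθ1 hcd hρ' hρ1'
  rw [two_mul_sq_two_sqrt_two] at h
  exact h

/-! ### The rows -/

/-- **TIER-2 ROW `(β_W, ε) = (1 / 4, 14 / 125)`, `SU(2)`, `d = 3`, WEIGHTED ROBUST STAR DOOR**, rate `1/100` per lattice unit, EVERY weight `κ ≥ 1/100`: Y4's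
receiving currency on the weighted ball `ClusterDomain κ (28 / 125) (14 / 125)` up to tree coupling `1 / 8` (Wilson `β_W = 1 / 4`)
at rate `1 / 100`, plus the torus form (certificate: `c = 102963 / 1000000`, `λ = 158393 / 1000000`, `ρ ≈ 0.9903`);
HYPOTHESIS-FREE. [folklore] -/
theorem su2_clusterDomainClusteringW_dim3_star_oneQuarter_t100 :
    ∀ κ : ℝ, 1 / 100 ≤ κ →
      YM3IR.ClusterDomainClustering (G := SUN 2)
          ⟨fundamentalRep (Fin 2), 1 / 8, fun _ _ W => W ∈ ClusterDomain κ (28 / 125) (14 / 125)⟩ suFrobDist (1 / 100) ∧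
        ∀ β : ℝ, 0 ≤ β → β ≤ 1 / 8 → TorusClusteringOnBallW 2 3 β κ (28 / 125) (14 / 125) (16 * Real.exp (1 / 50)) (1 / 100) := by
  intro κ hκ
  have e1 : (1 / 4 : ℝ) / 2 = 1 / 8 := by norm_num
  have h := su2_clusterDomainClusteringW_dim3_star 20 (βW := 1 / 4) (κ := κ) (ε₀ := 28 / 125) (ε₁ := 14 / 125)
    (c := 102963 / 1000000) (lam := 158393 / 1000000) (t := 1 / 100) (T₁ := 1010051 / 1000000) (T₂ := 510101 / 500000)
    (by norm_num) (by norm_num) (by norm_num) (by norm_num) hκ exp_le_28_125_star sqrt_two_le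
    exp_le_1_100_w (by rw [show (2:ℝ) * (1 / 100) = 1 / 50 by norm_num]; exact exp_le_1_50_w)
    (by norm_num) (by norm_num) (by norm_num) (by unfold doorPoly; norm_num)
    (by unfold gaugeR Delta; norm_num)
  have e2 : (2 : ℝ) * (1 / 100) = 1 / 50 := by norm_num
  rw [e1, e2] at h
  exact h

/-- **TIER-2 ROW `(β_W, ε) = (3 / 10, 89 / 1000)`, `SU(2)`, `d = 3`, WEIGHTED ROBUST STAR DOOR**, rate `1/100` per lattice unit, EVERY weight `κ ≥ 1/100`: Y4's
receiving currency on the weighted ball `ClusterDomain κ (89 / 500) (89 / 1000)` up to tree coupling `3 / 20` (Wilson `β_W = 3 / 10`)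
at rate `1 / 100`, plus the torus form (certificate: `c = 112171 / 1000000`, `λ = 62933 / 500000`, `ρ ≈ 0.9998`);
HYPOTHESIS-FREE. [folklore] -/
theorem su2_clusterDomainClusteringW_dim3_star_threeTenths_t100 :
    ∀ κ : ℝ, 1 / 100 ≤ κ →
      YM3IR.ClusterDomainClustering (G := SUN 2)
          ⟨fundamentalRep (Fin 2), 3 / 20, fun _ _ W => W ∈ ClusterDomain κ (89 / 500) (89 / 1000)⟩ suFrobDist (1 / 100) ∧
        ∀ β : ℝ, 0 ≤ β → β ≤ 3 / 20 → TorusClusteringOnBallW 2 3 β κ (89 / 500) (89 / 1000) (16 * Real.exp (1 / 50)) (1 / 100) := by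
  intro κ hκ
  have e1 : (3 / 10 : ℝ) / 2 = 3 / 20 := by norm_num
  have h := su2_clusterDomainClusteringW_dim3_star 20 (βW := 3 / 10) (κ := κ) (ε₀ := 89 / 500) (ε₁ := 89 / 1000)
    (c := 112171 / 1000000) (lam := 62933 / 500000) (t := 1 / 100) (T₁ := 1010051 / 1000000) (T₂ := 510101 / 500000)
    (by norm_num) (by norm_num) (by norm_num) (by norm_num) hκ exp_le_89_500_w3 sqrt_two_le
    exp_le_1_100_w (by rw [show (2:ℝ) * (1 / 100) = 1 / 50 by norm_num]; exact exp_le_1_50_w)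
    (by norm_num) (by norm_num) (by norm_num) (by unfold doorPoly; norm_num)
    (by unfold gaugeR Delta; norm_num)
  have e2 : (2 : ℝ) * (1 / 100) = 1 / 50 := by norm_num
  rw [e1, e2] at h
  exact h

/-- **TIER-2 ROW `(β_W, ε) = (2 / 5, 49 / 1000)`, `SU(2)`, `d = 3`, WEIGHTED ROBUST STAR DOOR**, rate `1/100` per lattice unit, EVERY weight `κ ≥ 1/100`: Y4's
receiving currency on the weighted ball `ClusterDomain κ (49 / 500) (49 / 1000)` up to tree coupling `1 / 5` (Wilson `β_W = 2 / 5`)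
at rate `1 / 100`, plus the torus form (certificate: `c = 125583 / 1000000`, `λ = 69297 / 1000000`, `ρ ≈ 0.9995`);
HYPOTHESIS-FREE. [folklore] -/
theorem su2_clusterDomainClusteringW_dim3_star_twoFifths_t100 :
    ∀ κ : ℝ, 1 / 100 ≤ κ →
      YM3IR.ClusterDomainClustering (G := SUN 2)
          ⟨fundamentalRep (Fin 2), 1 / 5, fun _ _ W => W ∈ ClusterDomain κ (49 / 500) (49 / 1000)⟩ suFrobDist (1 / 100) ∧
        ∀ β : ℝ, 0 ≤ β → β ≤ 1 / 5 → TorusClusteringOnBallW 2 3 β κ (49 / 500) (49 / 1000) (16 * Real.exp (1 / 50)) (1 / 100) := by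
  intro κ hκ
  have e1 : (2 / 5 : ℝ) / 2 = 1 / 5 := by norm_num
  have h := su2_clusterDomainClusteringW_dim3_star 20 (βW := 2 / 5) (κ := κ) (ε₀ := 49 / 500) (ε₁ := 49 / 1000)
    (c := 125583 / 1000000) (lam := 69297 / 1000000) (t := 1 / 100) (T₁ := 1010051 / 1000000) (T₂ := 510101 / 500000)
    (by norm_num) (by norm_num) (by norm_num) (by norm_num) hκ exp_098_le sqrt_two_le
    exp_le_1_100_w (by rw [show (2:ℝ) * (1 / 100) = 1 / 50 by norm_num]; exact exp_le_1_50_w)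
    (by norm_num) (by norm_num) (by norm_num) (by unfold doorPoly; norm_num)
    (by unfold gaugeR Delta; norm_num)
  have e2 : (2 : ℝ) * (1 / 100) = 1 / 50 := by norm_num
  rw [e1, e2] at h
  exact h

/-- **TIER-2 ROW `(β_W, ε) = (1 / 2, 2 / 125)`, `SU(2)`, `d = 3`, WEIGHTED ROBUST STAR DOOR**, rate `1/100` per lattice unit, EVERY weight `κ ≥ 1/100`: Y4's
receiving currency on the weighted ball `ClusterDomain κ (4 / 125) (2 / 125)` up to tree coupling `1 / 4` (Wilson `β_W = 1 / 2`)
at rate `1 / 100`, plus the torus form (certificate: `c = 67453 / 500000`, `λ = 5657 / 250000`, `ρ ≈ 0.9942`);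
HYPOTHESIS-FREE. [folklore] -/
theorem su2_clusterDomainClusteringW_dim3_star_oneHalf_t100 :
    ∀ κ : ℝ, 1 / 100 ≤ κ →
      YM3IR.ClusterDomainClustering (G := SUN 2)
          ⟨fundamentalRep (Fin 2), 1 / 4, fun _ _ W => W ∈ ClusterDomain κ (4 / 125) (2 / 125)⟩ suFrobDist (1 / 100) ∧
        ∀ β : ℝ, 0 ≤ β → β ≤ 1 / 4 → TorusClusteringOnBallW 2 3 β κ (4 / 125) (2 / 125) (16 * Real.exp (1 / 50)) (1 / 100) := by
  intro κ hκ
  have e1 : (1 / 2 : ℝ) / 2 = 1 / 4 := by norm_num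
  have h := su2_clusterDomainClusteringW_dim3_star 20 (βW := 1 / 2) (κ := κ) (ε₀ := 4 / 125) (ε₁ := 2 / 125)
    (c := 67453 / 500000) (lam := 5657 / 250000) (t := 1 / 100) (T₁ := 1010051 / 1000000) (T₂ := 510101 / 500000)
    (by norm_num) (by norm_num) (by norm_num) (by norm_num) hκ exp_le_4_125_w3 sqrt_two_le
    exp_le_1_100_w (by rw [show (2:ℝ) * (1 / 100) = 1 / 50 by norm_num]; exact exp_le_1_50_w)
    (by norm_num) (by norm_num) (by norm_num) (by unfold doorPoly; norm_num)
    (by unfold gaugeR Delta; norm_num)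
  have e2 : (2 : ℝ) * (1 / 100) = 1 / 50 := by norm_num
  rw [e1, e2] at h
  exact h

/-- **TIER-2 ROW `(β_W, ε) = (1 / 4, 83 / 1000)`, `SU(2)`, `d = 3`, WEIGHTED ROBUST STAR DOOR**, the lineage weight and rate `κ = t = log(6/5)`: Y4's
receiving currency on the weighted ball `ClusterDomain κ (83 / 500) (83 / 1000)` up to tree coupling `1 / 8` (Wilson `β_W = 1 / 4`)
at rate `Real.log (6 / 5)`, plus the torus form (certificate: `c = 22777 / 250000`, `λ = 117381 / 1000000`, `ρ ≈ 0.9996`);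
HYPOTHESIS-FREE. [folklore] -/
theorem su2_clusterDomainClusteringW_dim3_star_oneQuarter_w65 :
    YM3IR.ClusterDomainClustering (G := SUN 2)
          ⟨fundamentalRep (Fin 2), 1 / 8, fun _ _ W => W ∈ ClusterDomain (Real.log (6 / 5)) (83 / 500) (83 / 1000)⟩ suFrobDist
          (Real.log (6 / 5)) ∧
        ∀ β : ℝ, 0 ≤ β → β ≤ 1 / 8 →
          TorusClusteringOnBallW 2 3 β (Real.log (6 / 5)) (83 / 500) (83 / 1000) (16 * Real.exp (2 * Real.log (6 / 5))) (Real.log (6 / 5)) := by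
  have e1 : (1 / 4 : ℝ) / 2 = 1 / 8 := by norm_num
  have h := su2_clusterDomainClusteringW_dim3_star 20 (βW := 1 / 4) (κ := Real.log (6 / 5)) (ε₀ := 83 / 500) (ε₁ := 83 / 1000)
    (c := 22777 / 250000) (lam := 117381 / 1000000) (t := Real.log (6 / 5)) (T₁ := 6 / 5) (T₂ := 36 / 25)
    (by norm_num) (by norm_num) (by norm_num) (Real.log_nonneg (by norm_num)) le_rfl exp_le_83_500_cstar3 sqrt_two_le
    (by rw [Real.exp_log (by norm_num)]) (by rw [show (2:ℝ) * Real.log (6 / 5) = Real.log ((6 / 5) ^ 2) by rw [Real.log_pow]; norm_num, Real.exp_log (by norm_num)]; norm_num)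
    (by norm_num) (by norm_num) (by norm_num) (by unfold doorPoly; norm_num)
    (by unfold gaugeR Delta; norm_num)
  rw [e1] at h
  exact h

/-- **TIER-2 ROW `(β_W, ε) = (1 / 3, 51 / 1000)`, `SU(2)`, `d = 3`, WEIGHTED ROBUST STAR DOOR**, the lineage weight and rate `κ = t = log(6/5)`: Y4's
receiving currency on the weighted ball `ClusterDomain κ (51 / 500) (51 / 1000)` up to tree coupling `1 / 6` (Wilson `β_W = 1 / 3`)
at rate `Real.log (6 / 5)`, plus the torus form (certificate: `c = 52797 / 500000`, `λ = 36063 / 500000`, `ρ ≈ 0.9995`);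
HYPOTHESIS-FREE. [folklore] -/
theorem su2_clusterDomainClusteringW_dim3_star_oneThird_w65 :
    YM3IR.ClusterDomainClustering (G := SUN 2)
          ⟨fundamentalRep (Fin 2), 1 / 6, fun _ _ W => W ∈ ClusterDomain (Real.log (6 / 5)) (51 / 500) (51 / 1000)⟩ suFrobDist
          (Real.log (6 / 5)) ∧
        ∀ β : ℝ, 0 ≤ β → β ≤ 1 / 6 →
          TorusClusteringOnBallW 2 3 β (Real.log (6 / 5)) (51 / 500) (51 / 1000) (16 * Real.exp (2 * Real.log (6 / 5))) (Real.log (6 / 5)) := by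
  have e1 : (1 / 3 : ℝ) / 2 = 1 / 6 := by norm_num
  have h := su2_clusterDomainClusteringW_dim3_star 20 (βW := 1 / 3) (κ := Real.log (6 / 5)) (ε₀ := 51 / 500) (ε₁ := 51 / 1000)
    (c := 52797 / 500000) (lam := 36063 / 500000) (t := Real.log (6 / 5)) (T₁ := 6 / 5) (T₂ := 36 / 25)
    (by norm_num) (by norm_num) (by norm_num) (Real.log_nonneg (by norm_num)) le_rfl exp_le_51_500_cstar3 sqrt_two_le
    (by rw [Real.exp_log (by norm_num)]) (by rw [show (2:ℝ) * Real.log (6 / 5) = Real.log ((6 / 5) ^ 2) by rw [Real.log_pow]; norm_num, Real.exp_log (by norm_num)]; norm_num)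
    (by norm_num) (by norm_num) (by norm_num) (by unfold doorPoly; norm_num)
    (by unfold gaugeR Delta; norm_num)
  rw [e1] at h
  exact h

/-- **TIER-2 ROW `(β_W, ε) = (9 / 20, 7 / 500)`, `SU(2)`, `d = 3`, WEIGHTED ROBUST STAR DOOR**, the lineage weight and rate `κ = t = log(6/5)`: Y4's
receiving currency on the weighted ball `ClusterDomain κ (7 / 250) (7 / 500)` up to tree coupling `9 / 40` (Wilson `β_W = 9 / 20`)
at rate `Real.log (6 / 5)`, plus the torus form (certificate: `c = 30069 / 250000`, `λ = 99 / 5000`, `ρ ≈ 0.9904`);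
HYPOTHESIS-FREE. [folklore] -/
theorem su2_clusterDomainClusteringW_dim3_star_nineTwentieths_w65 :
    YM3IR.ClusterDomainClustering (G := SUN 2)
          ⟨fundamentalRep (Fin 2), 9 / 40, fun _ _ W => W ∈ ClusterDomain (Real.log (6 / 5)) (7 / 250) (7 / 500)⟩ suFrobDist
          (Real.log (6 / 5)) ∧
        ∀ β : ℝ, 0 ≤ β → β ≤ 9 / 40 →
          TorusClusteringOnBallW 2 3 β (Real.log (6 / 5)) (7 / 250) (7 / 500) (16 * Real.exp (2 * Real.log (6 / 5))) (Real.log (6 / 5)) := by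
  have e1 : (9 / 20 : ℝ) / 2 = 9 / 40 := by norm_num
  have h := su2_clusterDomainClusteringW_dim3_star 20 (βW := 9 / 20) (κ := Real.log (6 / 5)) (ε₀ := 7 / 250) (ε₁ := 7 / 500)
    (c := 30069 / 250000) (lam := 99 / 5000) (t := Real.log (6 / 5)) (T₁ := 6 / 5) (T₂ := 36 / 25)
    (by norm_num) (by norm_num) (by norm_num) (Real.log_nonneg (by norm_num)) le_rfl exp_le_7_250_w3 sqrt_two_le
    (by rw [Real.exp_log (by norm_num)]) (by rw [show (2:ℝ) * Real.log (6 / 5) = Real.log ((6 / 5) ^ 2) by rw [Real.log_pow]; norm_num, Real.exp_log (by norm_num)]; norm_num)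
    (by norm_num) (by norm_num) (by norm_num) (by unfold doorPoly; norm_num)
    (by unfold gaugeR Delta; norm_num)
  rw [e1] at h
  exact h

/-- **TIER-2 ROW `(β_W, ε) = (1 / 4, 49 / 1000)`, `SU(2)`, `d = 3`, WEIGHTED ROBUST STAR DOOR**, the weight and rate `κ = t = log(3/2)`: Y4's
receiving currency on the weighted ball `ClusterDomain κ (49 / 500) (49 / 1000)` up to tree coupling `1 / 8` (Wilson `β_W = 1 / 4`)
at rate `Real.log (3 / 2)`, plus the torus form (certificate: `c = 7849 / 100000`, `λ = 69297 / 1000000`, `ρ ≈ 0.9998`);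
HYPOTHESIS-FREE. [folklore] -/
theorem su2_clusterDomainClusteringW_dim3_star_oneQuarter_w32 :
    YM3IR.ClusterDomainClustering (G := SUN 2)
          ⟨fundamentalRep (Fin 2), 1 / 8, fun _ _ W => W ∈ ClusterDomain (Real.log (3 / 2)) (49 / 500) (49 / 1000)⟩ suFrobDist
          (Real.log (3 / 2)) ∧
        ∀ β : ℝ, 0 ≤ β → β ≤ 1 / 8 →
          TorusClusteringOnBallW 2 3 β (Real.log (3 / 2)) (49 / 500) (49 / 1000) (16 * Real.exp (2 * Real.log (3 / 2))) (Real.log (3 / 2)) := by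
  have e1 : (1 / 4 : ℝ) / 2 = 1 / 8 := by norm_num
  have h := su2_clusterDomainClusteringW_dim3_star 20 (βW := 1 / 4) (κ := Real.log (3 / 2)) (ε₀ := 49 / 500) (ε₁ := 49 / 1000)
    (c := 7849 / 100000) (lam := 69297 / 1000000) (t := Real.log (3 / 2)) (T₁ := 3 / 2) (T₂ := 9 / 4)
    (by norm_num) (by norm_num) (by norm_num) (Real.log_nonneg (by norm_num)) le_rfl exp_098_le sqrt_two_le
    (by rw [Real.exp_log (by norm_num)]) (by rw [show (2:ℝ) * Real.log (3 / 2) = Real.log ((3 / 2) ^ 2) by rw [Real.log_pow]; norm_num, Real.exp_log (by norm_num)]; norm_num)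
    (by norm_num) (by norm_num) (by norm_num) (by unfold doorPoly; norm_num)
    (by unfold gaugeR Delta; norm_num)
  rw [e1] at h
  exact h

/-- **TIER-2 ROW `(β_W, ε) = (1 / 3, 1 / 40)`, `SU(2)`, `d = 3`, WEIGHTED ROBUST STAR DOOR**, the weight and rate `κ = t = log(3/2)`: Y4's
receiving currency on the weighted ball `ClusterDomain κ (1 / 20) (1 / 40)` up to tree coupling `1 / 6` (Wilson `β_W = 1 / 3`)
at rate `Real.log (3 / 2)`, plus the torus form (certificate: `c = 93801 / 1000000`, `λ = 8839 / 250000`, `ρ ≈ 0.9945`);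
HYPOTHESIS-FREE. [folklore] -/
theorem su2_clusterDomainClusteringW_dim3_star_oneThird_w32 :
    YM3IR.ClusterDomainClustering (G := SUN 2)
          ⟨fundamentalRep (Fin 2), 1 / 6, fun _ _ W => W ∈ ClusterDomain (Real.log (3 / 2)) (1 / 20) (1 / 40)⟩ suFrobDist
          (Real.log (3 / 2)) ∧
        ∀ β : ℝ, 0 ≤ β → β ≤ 1 / 6 →
          TorusClusteringOnBallW 2 3 β (Real.log (3 / 2)) (1 / 20) (1 / 40) (16 * Real.exp (2 * Real.log (3 / 2))) (Real.log (3 / 2)) := by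
  have e1 : (1 / 3 : ℝ) / 2 = 1 / 6 := by norm_num
  have h := su2_clusterDomainClusteringW_dim3_star 20 (βW := 1 / 3) (κ := Real.log (3 / 2)) (ε₀ := 1 / 20) (ε₁ := 1 / 40)
    (c := 93801 / 1000000) (lam := 8839 / 250000) (t := Real.log (3 / 2)) (T₁ := 3 / 2) (T₂ := 9 / 4)
    (by norm_num) (by norm_num) (by norm_num) (Real.log_nonneg (by norm_num)) le_rfl exp_le_1_20_w3 sqrt_two_le
    (by rw [Real.exp_log (by norm_num)]) (by rw [show (2:ℝ) * Real.log (3 / 2) = Real.log ((3 / 2) ^ 2) by rw [Real.log_pow]; norm_num, Real.exp_log (by norm_num)]; norm_num)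
    (by norm_num) (by norm_num) (by norm_num) (by unfold doorPoly; norm_num)
    (by unfold gaugeR Delta; norm_num)
  rw [e1] at h
  exact h

end Summit.Ventures.YMGap.RobustBall

end
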